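import Summits.CriticalPhenomena.PercolationContinuityZ3.Theorems.SahiRandomClusterCrossBox
import Summits.CriticalPhenomena.PercolationContinuityZ3.Theorems.SahiIsingHolleyNonlocal

/-!
# Stochastic ordering of the limit random-cluster measures of `ℤ^d` in the boundary condition and in `p`, for ALL
# measurable increasing functionals: Holley's inequality for laws of random sets, density-free

Support file of the Sahi cell (`prim-sahi`, typer seat, generation 16; `--supports stmt-CriticalPhenomena-4575`).
Theorems only (no definitions, no named facts, no sorries).  Second half of the random-cluster companion of generation
15's `SahiIsingCrossBox.lean` (first half: `SahiRandomClusterCrossBox.lean`, the cross box condition for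
`φ^W_{Λ,p,q}, φ^{W'}_{Λ,p',q}` with `(p, W) ≤ (p', W')`).

* `isLocalEvent_Icc_face`, `antitone_Icc_face`, `iInter_Icc_face`, **`crossBox_of_tendsto_local_set`** — on `Set ι`
  (`ι` countable) the cross box condition passes to limits on LOCAL events (the faces `[a ∩ J, b ∪ Jᶜ]` of a box over
  an exhaustion are local and decrease to the box); hence **`crossBox_of_isRandomClusterLimit`: the limits
  `φ^b_{p,q}`, `φ^{b'}_{p',q}` of `ℤ^d` (tree `IsRandomClusterLimit`) with `b ≤ b'` boxwise and `p ≤ p'` satisfy the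
  cross box condition**.
* `crossBox_map_orderIso`, **`holley_upperSet_of_crossBox_set`**, `holley_integral_of_crossBox_set`,
  **`holley_of_crossBox_set`** — HOLLEY'S INEQUALITY FOR LAWS OF RANDOM SETS, density-free, infinite volume (transport
  of generation 15's `holley_upperSet_of_crossBox_spin` along the measurable order isomorphism `Set ι ≃o {−1,+1}^ι`):
  the cross box condition gives `μ(U) ν(Ω) ≤ μ(Ω) ν(U)` for every measurable increasing event and `∫ f dμ ≤ ∫ f dν`
  for every bounded measurable increasing functional.
* CONSEQUENCES (`isRandomClusterLimit_measure_le`, `isRandomClusterLimit_integral_le`,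
  `isRandomClusterLimit_free_le_wired`, `isRandomClusterLimit_mono_p`, `isRandomClusterLimit_percolatesAt_le`,
  `isRandomClusterLimit_anti_q`, `isRandomClusterLimit_integral_anti_q`): for
  the limit measures of `ℤ^d`, `0 ≤ p ≤ p' ≤ 1`, `q ≥ 1`, `b ≤ b'`: **`φ^b_{p,q}(U) ≤ φ^{b'}_{p',q}(U)` for EVERY
  measurable increasing event and `∫ f dφ^b_{p,q} ≤ ∫ f dφ^{b'}_{p',q}` for EVERY bounded measurable increasing
  functional** — in particular `φ⁰_{p,q} ≤_st φ¹_{p,q}` and the monotonicity in `p` and in the boundary condition of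
  `φ^b_{p,q}(x ↔ ∞)`, non-local events; the printed comparison inequalities [Grimmett 2006, Thm. 3.21,
  Thm. (4.19)(c)–(d), (4.21)] are stated for increasing local / continuous functions and monotone limits.

No sorries, no new axioms.
-/

noncomputable section

namespace Summit.CriticalPhenomena.PercolationContinuityZ3.Theorems.SahiBoxTP2

open MeasureTheory Set Filter Topology Function
open Literature.Probability.LatticeModels Literature.Probability.Percolation
open scoped ENNReal

/-! ### The cross box condition on `Set ι` passes to limits on local events -/

section SetLimit

variable {ι : Type*}

/-- The face of a box over the window `J`: `[a ∩ J, b ∪ Jᶜ]`, a local event. [folklore] -/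
theorem isLocalEvent_Icc_face (J : Finset ι) (a b : Set ι) : IsLocalEvent (Icc (a ∩ ↑J) (b ∪ (↑J)ᶜ)) := by
  refine ⟨J, (determinedBy_iff _ _).2 fun ω ω' h => ?_⟩
  simp only [Set.mem_Icc]
  have e1 : a ∩ ↑J ⊆ ω ↔ a ∩ ↑J ⊆ ω ∩ ↑J := ⟨fun h' x hx => ⟨h' hx, hx.2⟩, fun h' x hx => (h' hx).1⟩
  have e1' : a ∩ ↑J ⊆ ω' ↔ a ∩ ↑J ⊆ ω' ∩ ↑J := ⟨fun h' x hx => ⟨h' hx, hx.2⟩, fun h' x hx => (h' hx).1⟩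
  have e2 : ω ⊆ b ∪ (↑J)ᶜ ↔ ω ∩ ↑J ⊆ b := ⟨fun h' x hx => (h' hx.1).resolve_right fun h'' => h'' hx.2,
    fun h' x hx => by by_cases hJ : x ∈ (↑J : Set ι) <;> [exact Or.inl (h' ⟨hx, hJ⟩); exact Or.inr hJ]⟩
  have e2' : ω' ⊆ b ∪ (↑J)ᶜ ↔ ω' ∩ ↑J ⊆ b := ⟨fun h' x hx => (h' hx.1).resolve_right fun h'' => h'' hx.2,
    fun h' x hx => by by_cases hJ : x ∈ (↑J : Set ι) <;> [exact Or.inl (h' ⟨hx, hJ⟩); exact Or.inr hJ]⟩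
  rw [e1, e1', e2, e2', h]

/-- Faces shrink along a growing window. [folklore] -/
theorem antitone_Icc_face {J : ℕ → Finset ι} (hJ : Monotone J) (a b : Set ι) :
    Antitone fun m => Icc (a ∩ ↑(J m)) (b ∪ (↑(J m))ᶜ) := by
  intro m m' hmm' x hx
  exact ⟨(Set.inter_subset_inter_right a (Finset.coe_subset.2 (hJ hmm'))).trans hx.1,
    hx.2.trans (Set.union_subset_union_right b (Set.compl_subset_compl.2 (Finset.coe_subset.2 (hJ hmm'))))⟩

/-- Faces over an exhaustion decrease to the box. [folklore] -/
theorem iInter_Icc_face {J : ℕ → Finset ι} (hJ : ∀ v, ∃ m, v ∈ J m) (a b : Set ι) :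
    ⋂ m, Icc (a ∩ ↑(J m)) (b ∪ (↑(J m))ᶜ) = Icc a b := by
  ext x
  simp only [Set.mem_iInter, Set.mem_Icc]
  constructor
  · intro h
    refine ⟨fun v hv => ?_, fun v hv => ?_⟩
    · obtain ⟨m, hm⟩ := hJ v
      exact (h m).1 ⟨hv, hm⟩
    · obtain ⟨m, hm⟩ := hJ v
      exact ((h m).2 hv).resolve_right fun h' => h' hm
  · intro h m
    exact ⟨inter_subset_left.trans h.1, h.2.trans subset_union_left⟩

/-- Faces commute with `∩`/`∪` of the corners. [folklore] -/
theorem Icc_face_inf (J : Set ι) (a b a' b' : Set ι) :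
    Icc ((a ⊓ a') ∩ J) ((b ⊓ b') ∪ Jᶜ) = Icc (a ∩ J ⊓ (a' ∩ J)) ((b ∪ Jᶜ) ⊓ (b' ∪ Jᶜ)) := by
  congr 1
  · simp only [Set.inf_eq_inter]; ext x; simp only [Set.mem_inter_iff]; tauto
  · simp only [Set.inf_eq_inter]; ext x; simp only [Set.mem_inter_iff, Set.mem_union, Set.mem_compl_iff]; tauto

/-- Faces commute with `∪` of the corners. [folklore] -/
theorem Icc_face_sup (J : Set ι) (a b a' b' : Set ι) :
    Icc ((a ⊔ a') ∩ J) ((b ⊔ b') ∪ Jᶜ) = Icc (a ∩ J ⊔ (a' ∩ J)) ((b ∪ Jᶜ) ⊔ (b' ∪ Jᶜ)) := by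
  congr 1
  · simp only [Set.sup_eq_union]; rw [Set.union_inter_distrib_right]
  · simp only [Set.sup_eq_union]; ext x; simp only [Set.mem_union, Set.mem_compl_iff]; tauto

/-- **The cross box condition on `Set ι` is closed under convergence on local events of two sequences** of finite
measures. [this work] -/
theorem crossBox_of_tendsto_local_set [Countable ι] (μs νs : ℕ → Measure (Set ι)) (μ ν : Measure (Set ι))
    [∀ n, IsFiniteMeasure (μs n)] [∀ n, IsFiniteMeasure (νs n)] [IsFiniteMeasure μ] [IsFiniteMeasure ν]
    (hcross : ∀ n (a b a' b' : Set ι), μs n (Icc a b) * νs n (Icc a' b') ≤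
      μs n (Icc (a ⊓ a') (b ⊓ b')) * νs n (Icc (a ⊔ a') (b ⊔ b')))
    (hconvμ : ∀ A : Set (Set ι), IsLocalEvent A → Tendsto (fun n => μs n A) atTop (𝓝 (μ A)))
    (hconvν : ∀ A : Set (Set ι), IsLocalEvent A → Tendsto (fun n => νs n A) atTop (𝓝 (ν A)))
    (a b a' b' : Set ι) :
    μ (Icc a b) * ν (Icc a' b') ≤ μ (Icc (a ⊓ a') (b ⊓ b')) * ν (Icc (a ⊔ a') (b ⊔ b')) := by
  classical
  obtain ⟨J, hJm, hJ⟩ := exists_finset_exhaustion (ι := ι)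
  set F : ℕ → Set ι → Set ι → Set (Set ι) := fun m p q => Icc (p ∩ ↑(J m)) (q ∪ (↑(J m))ᶜ) with hF
  have hFm : ∀ m p q, MeasurableSet (F m p q) := fun m p q => measurableSet_Icc_set _ _
  have hFl : ∀ m p q, IsLocalEvent (F m p q) := fun m p q => isLocalEvent_Icc_face (J m) p q
  have hface : ∀ m, μ (F m a b) * ν (F m a' b') ≤ μ (F m (a ⊓ a') (b ⊓ b')) * ν (F m (a ⊔ a') (b ⊔ b')) := by
    intro m
    refine le_of_tendsto_of_tendsto'
      (ENNReal.Tendsto.mul (hconvμ _ (hFl m a b)) (Or.inr (measure_ne_top _ _)) (hconvν _ (hFl m a' b'))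
        (Or.inr (measure_ne_top _ _)))
      (ENNReal.Tendsto.mul (hconvμ _ (hFl m _ _)) (Or.inr (measure_ne_top _ _)) (hconvν _ (hFl m _ _))
        (Or.inr (measure_ne_top _ _))) fun n => ?_
    have key := hcross n (a ∩ ↑(J m)) (b ∪ (↑(J m))ᶜ) (a' ∩ ↑(J m)) (b' ∪ (↑(J m))ᶜ)
    simp only [hF]
    rw [Icc_face_inf, Icc_face_sup]
    exact key
  have hlim : ∀ (ρ : Measure (Set ι)) [IsFiniteMeasure ρ] (p q : Set ι),
      Tendsto (fun m => ρ (F m p q)) atTop (𝓝 (ρ (Icc p q))) := by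
    intro ρ _ p q
    have h := tendsto_measure_iInter_atTop (μ := ρ) (fun m => (hFm m p q).nullMeasurableSet)
      (antitone_Icc_face hJm p q) ⟨0, measure_ne_top _ _⟩
    simp only [hF] at h
    rw [iInter_Icc_face hJ p q] at h
    exact h
  exact le_of_tendsto_of_tendsto'
    (ENNReal.Tendsto.mul (hlim μ a b) (Or.inr (measure_ne_top _ _)) (hlim ν a' b') (Or.inr (measure_ne_top _ _)))
    (ENNReal.Tendsto.mul (hlim μ (a ⊓ a') (b ⊓ b')) (Or.inr (measure_ne_top _ _)) (hlim ν (a ⊔ a') (b ⊔ b'))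
      (Or.inr (measure_ne_top _ _))) fun m => hface m

end SetLimit

/-! ### Holley's inequality for laws of random sets, density-free -/

section SetHolley

variable {ι : Type*} [Countable ι]

/-- **The cross box condition is transported along measurable order isomorphisms.** [this work] -/
theorem crossBox_map_orderIso {X Y : Type*} [Lattice X] [Lattice Y] [MeasurableSpace X] [MeasurableSpace Y]
    (Φ : X ≃o Y) (hΦ : Measurable Φ) (hIcc : ∀ a b : Y, MeasurableSet (Icc a b)) (μ ν : Measure X)
    (h : ∀ a b a' b' : X, μ (Icc a b) * ν (Icc a' b') ≤ μ (Icc (a ⊓ a') (b ⊓ b')) * ν (Icc (a ⊔ a') (b ⊔ b')))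
    (a b a' b' : Y) :
    μ.map Φ (Icc a b) * ν.map Φ (Icc a' b') ≤
      μ.map Φ (Icc (a ⊓ a') (b ⊓ b')) * ν.map Φ (Icc (a ⊔ a') (b ⊔ b')) := by
  simp only [Measure.map_apply hΦ (hIcc _ _), OrderIso.preimage_Icc, OrderIso.map_inf, OrderIso.map_sup]
  exact h _ _ _ _

/-- **HOLLEY'S INEQUALITY FOR RANDOM SUBSETS OF A COUNTABLE SET, DENSITY-FREE**: finite measures `μ, ν` on `Set ι` with
the cross box condition satisfy `μ(U) ν(Ω) ≤ μ(Ω) ν(U)` for every measurable increasing event `U` (transport to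
`{−1,+1}^ι` and generation 15's `holley_upperSet_of_crossBox_spin`). [this work] -/
theorem holley_upperSet_of_crossBox_set (μ ν : Measure (Set ι)) [IsFiniteMeasure μ] [IsFiniteMeasure ν]
    (hcross : ∀ a b a' b' : Set ι, μ (Icc a b) * ν (Icc a' b') ≤
      μ (Icc (a ⊓ a') (b ⊓ b')) * ν (Icc (a ⊔ a') (b ⊔ b')))
    {U : Set (Set ι)} (hU : IsUpperSet U) (hUm : MeasurableSet U) : μ U * ν univ ≤ μ univ * ν U := by
  classical
  -- the measurable order isomorphism `Set ι ≃o (ι → ℤˣ)`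
  set M : (ι → ℤˣ) ≃ᵐ (ι → Bool) := MeasurableEquiv.piCongrRight fun _ : ι => unitsIntEquivBool with hM
  set Ψ : (ι → Bool) ≃o (ι → ℤˣ) :=
    M.symm.toEquiv.toOrderIso (fun x y hxy => piCongrRight_unitsIntEquivBool_symm_mono hxy)
      (fun x y hxy => piCongrRight_unitsIntEquivBool_mono hxy) with hΨ
  set Φ : Set ι ≃o (ι → ℤˣ) := (setBoolIso (ι := ι)).trans Ψ with hΦ
  have hΦm : Measurable Φ := by
    change Measurable (fun x => M.symm (setBoolIso x))
    exact M.symm.measurable.comp measurable_setBoolIso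
  have hΦsm : Measurable Φ.symm := by
    change Measurable (fun u => (setBoolIso (ι := ι)).symm (M u))
    exact measurable_setBoolIso_symm.comp M.measurable
  haveI : IsFiniteMeasure (μ.map Φ) := Measure.isFiniteMeasure_map μ _
  haveI : IsFiniteMeasure (ν.map Φ) := Measure.isFiniteMeasure_map ν _
  have hc := crossBox_map_orderIso Φ hΦm measurableSet_Icc_spinConfig μ ν hcross
  set V := Φ.symm ⁻¹' U with hV
  have hVup : IsUpperSet V := hU.preimage Φ.symm.monotone
  have hVm : MeasurableSet V := hΦsm hUm
  have hpre : Φ ⁻¹' V = U := by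
    ext x; simp [hV]
  have key := holley_upperSet_of_crossBox_spin (μ.map Φ) (ν.map Φ) hc hVup hVm
  rw [Measure.map_apply hΦm hVm, Measure.map_apply hΦm hVm, Measure.map_apply hΦm MeasurableSet.univ,
    Measure.map_apply hΦm MeasurableSet.univ, hpre, Set.preimage_univ] at key
  exact key

/-- Integral form: `(∫ h dμ) ν(Ω) ≤ μ(Ω) ∫ h dν` for bounded measurable increasing `h`. [this work] -/
theorem holley_integral_of_crossBox_set (μ ν : Measure (Set ι)) [IsFiniteMeasure μ] [IsFiniteMeasure ν]
    (hcross : ∀ a b a' b' : Set ι, μ (Icc a b) * ν (Icc a' b') ≤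
      μ (Icc (a ⊓ a') (b ⊓ b')) * ν (Icc (a ⊔ a') (b ⊔ b')))
    {h : Set ι → ℝ} (hh : Monotone h) (hhm : Measurable h) {C : ℝ} (hhC : ∀ x, |h x| ≤ C) :
    (∫ x, h x ∂μ) * ν.real univ ≤ μ.real univ * ∫ x, h x ∂ν :=
  integral_mul_le_mul_integral_of_upperSets μ ν (fun _ hU hUm => holley_upperSet_of_crossBox_set μ ν hcross hU hUm)
    hh hhm hhC

/-- **Holley's inequality for probability measures on `Set ι` with the cross box condition: `∫ h dμ ≤ ∫ h dν` for
every bounded measurable increasing functional.** [this work] -/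
theorem holley_of_crossBox_set (μ ν : Measure (Set ι)) [IsProbabilityMeasure μ] [IsProbabilityMeasure ν]
    (hcross : ∀ a b a' b' : Set ι, μ (Icc a b) * ν (Icc a' b') ≤
      μ (Icc (a ⊓ a') (b ⊓ b')) * ν (Icc (a ⊔ a') (b ⊔ b')))
    {h : Set ι → ℝ} (hh : Monotone h) (hhm : Measurable h) {C : ℝ} (hhC : ∀ x, |h x| ≤ C) :
    ∫ x, h x ∂μ ≤ ∫ x, h x ∂ν := by
  simpa only [probReal_univ, mul_one, one_mul] using holley_integral_of_crossBox_set μ ν hcross hh hhm hhC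

end SetHolley

/-! ### The limits `φ^b_{p,q}` of `ℤ^d`: free ≤ wired and monotonicity in `p`, for all measurable functionals -/

section Limit

variable {d : ℕ} {b b' : RCBoundary} {p p' q q' : ℝ} {P P' : Measure (BondConfig (Site d))}

/-- **Two limit random-cluster measures of `ℤ^d` whose box laws satisfy the cross box condition satisfy it.**
[this work] -/
theorem crossBox_of_isRandomClusterLimit_of_box (hP : IsRandomClusterLimit d b p q P)
    (hP' : IsRandomClusterLimit d b' p' q' P') (hp : p ∈ Set.Icc (0 : ℝ) 1) (hq : 0 < q) (hp' : p' ∈ Set.Icc (0 : ℝ) 1)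
    (hq' : 0 < q')
    (hbox : ∀ (n : ℕ) (a c a' c' : BondConfig (Site d)), rcBoxLaw d b p q n (Icc a c) * rcBoxLaw d b' p' q' n (Icc a' c') ≤
      rcBoxLaw d b p q n (Icc (a ⊓ a') (c ⊓ c')) * rcBoxLaw d b' p' q' n (Icc (a ⊔ a') (c ⊔ c')))
    (a c a' c' : BondConfig (Site d)) :
    P (Icc a c) * P' (Icc a' c') ≤ P (Icc (a ⊓ a') (c ⊓ c')) * P' (Icc (a ⊔ a') (c ⊔ c')) := by
  haveI := hP.isProbabilityMeasure
  haveI := hP'.isProbabilityMeasure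
  haveI : ∀ n, IsProbabilityMeasure (rcBoxLaw d b p q n) := fun n =>
    isProbabilityMeasure_rcBoxLaw (d := d) b hp hq n
  haveI : ∀ n, IsProbabilityMeasure (rcBoxLaw d b' p' q' n) := fun n =>
    isProbabilityMeasure_rcBoxLaw (d := d) b' hp' hq' n
  exact crossBox_of_tendsto_local_set (fun n => rcBoxLaw d b p q n) (fun n => rcBoxLaw d b' p' q' n) P P' hbox
    hP.tendsto_isLocalEvent hP'.tendsto_isLocalEvent a c a' c'

/-- **The limit measures `φ^b_{p,q}`, `φ^{b'}_{p',q}` with `b ≤ b'` boxwise (e.g. `b` free or `b'` wired), `p ≤ p'`,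
`q ≥ 1` satisfy the cross box condition.** [this work] -/
theorem crossBox_of_isRandomClusterLimit (hP : IsRandomClusterLimit d b p q P) (hP' : IsRandomClusterLimit d b' p' q P')
    (hp : p ∈ Set.Icc (0 : ℝ) 1) (hp' : p' ∈ Set.Icc (0 : ℝ) 1) (hpp : p ≤ p') (hq : 1 ≤ q)
    (hbb : ∀ n : ℕ, b.wiredSet (box d n) ⊆ b'.wiredSet (box d n)) (a c a' c' : BondConfig (Site d)) :
    P (Icc a c) * P' (Icc a' c') ≤ P (Icc (a ⊓ a') (c ⊓ c')) * P' (Icc (a ⊔ a') (c ⊔ c')) :=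
  crossBox_of_isRandomClusterLimit_of_box hP hP' hp (one_pos.trans_le hq) hp' (one_pos.trans_le hq)
    (fun n p₁ q₁ p₂ q₂ => crossBox_rcLaw hp hp' hpp hq (box d n) (hbb n) p₁ q₁ p₂ q₂) a c a' c'

/-- **The limit measures `φ^b_{p,q'}`, `φ^b_{p,q}` with `1 ≤ q ≤ q'` satisfy the cross box condition** (`φ_{p,q'}`
below). [this work] -/
theorem crossBox_of_isRandomClusterLimit_q (hP : IsRandomClusterLimit d b p q' P) (hP' : IsRandomClusterLimit d b p q P')
    (hp : p ∈ Set.Icc (0 : ℝ) 1) (hq : 1 ≤ q) (hqq : q ≤ q') (a c a' c' : BondConfig (Site d)) :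
    P (Icc a c) * P' (Icc a' c') ≤ P (Icc (a ⊓ a') (c ⊓ c')) * P' (Icc (a ⊔ a') (c ⊔ c')) :=
  crossBox_of_isRandomClusterLimit_of_box hP hP' hp (one_pos.trans_le (hq.trans hqq)) hp (one_pos.trans_le hq)
    (fun n p₁ q₁ p₂ q₂ => crossBox_rcLaw_q hp hq hqq (box d n) _ p₁ q₁ p₂ q₂) a c a' c'

/-- **`φ^b_{p,q}(U) ≤ φ^{b'}_{p',q}(U)` for EVERY measurable increasing event** of the infinite bond configuration
(`b`-wiring ≤ `b'`-wiring in every box, `0 ≤ p ≤ p' ≤ 1`, `q ≥ 1`). [this work] -/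
theorem isRandomClusterLimit_measure_le (hP : IsRandomClusterLimit d b p q P) (hP' : IsRandomClusterLimit d b' p' q P')
    (hp : p ∈ Set.Icc (0 : ℝ) 1) (hp' : p' ∈ Set.Icc (0 : ℝ) 1) (hpp : p ≤ p') (hq : 1 ≤ q)
    (hbb : ∀ n : ℕ, b.wiredSet (box d n) ⊆ b'.wiredSet (box d n)) {U : Set (BondConfig (Site d))}
    (hU : IsUpperSet U) (hUm : MeasurableSet U) : P U ≤ P' U := by
  haveI := hP.isProbabilityMeasure
  haveI := hP'.isProbabilityMeasure
  simpa only [measure_univ, mul_one, one_mul] using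
    holley_upperSet_of_crossBox_set P P' (crossBox_of_isRandomClusterLimit hP hP' hp hp' hpp hq hbb) hU hUm

/-- **`∫ f dφ^b_{p,q} ≤ ∫ f dφ^{b'}_{p',q}` for EVERY bounded measurable increasing functional.** [this work] -/
theorem isRandomClusterLimit_integral_le (hP : IsRandomClusterLimit d b p q P) (hP' : IsRandomClusterLimit d b' p' q P')
    (hp : p ∈ Set.Icc (0 : ℝ) 1) (hp' : p' ∈ Set.Icc (0 : ℝ) 1) (hpp : p ≤ p') (hq : 1 ≤ q)
    (hbb : ∀ n : ℕ, b.wiredSet (box d n) ⊆ b'.wiredSet (box d n)) {f : BondConfig (Site d) → ℝ} (hf : Monotone f)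
    (hfm : Measurable f) {C : ℝ} (hfC : ∀ x, |f x| ≤ C) : ∫ x, f x ∂P ≤ ∫ x, f x ∂P' := by
  haveI := hP.isProbabilityMeasure
  haveI := hP'.isProbabilityMeasure
  exact holley_of_crossBox_set P P' (crossBox_of_isRandomClusterLimit hP hP' hp hp' hpp hq hbb) hf hfm hfC

/-- **Free ≤ wired: `φ⁰_{p,q}(U) ≤ φ¹_{p',q}(U)`** for every measurable increasing event, `p ≤ p'`, `q ≥ 1` — e.g.
`θ⁰ ≤ θ¹` for the non-local event `{x ↔ ∞}`. [this work] -/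
theorem isRandomClusterLimit_free_le_wired (hP : IsRandomClusterLimit d RCBoundary.free p q P)
    (hP' : IsRandomClusterLimit d RCBoundary.wired p' q P') (hp : p ∈ Set.Icc (0 : ℝ) 1) (hp' : p' ∈ Set.Icc (0 : ℝ) 1)
    (hpp : p ≤ p') (hq : 1 ≤ q) {U : Set (BondConfig (Site d))} (hU : IsUpperSet U) (hUm : MeasurableSet U) :
    P U ≤ P' U :=
  isRandomClusterLimit_measure_le hP hP' hp hp' hpp hq (fun _ => RCBoundary.wiredSet_free_subset _ _) hU hUm

/-- **Monotonicity in `p` (same boundary condition): `φ^b_{p,q}(U) ≤ φ^b_{p',q}(U)`** for every measurable increasing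
event, `p ≤ p'`, `q ≥ 1`. [this work] -/
theorem isRandomClusterLimit_mono_p (hP : IsRandomClusterLimit d b p q P) (hP' : IsRandomClusterLimit d b p' q P')
    (hp : p ∈ Set.Icc (0 : ℝ) 1) (hp' : p' ∈ Set.Icc (0 : ℝ) 1) (hpp : p ≤ p') (hq : 1 ≤ q)
    {U : Set (BondConfig (Site d))} (hU : IsUpperSet U) (hUm : MeasurableSet U) : P U ≤ P' U :=
  isRandomClusterLimit_measure_le hP hP' hp hp' hpp hq (fun _ => subset_rfl) hU hUm

/-- **The infinite-volume percolation probability `φ^b_{p,q}(x ↔ ∞)` is increasing in `p` and in the boundary condition**: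
`φ^b_{p,q}(x ↔ ∞) ≤ φ^{b'}_{p',q}(x ↔ ∞)` (`b ≤ b'` boxwise, `p ≤ p'`, `q ≥ 1`). [this work] -/
theorem isRandomClusterLimit_percolatesAt_le [NeZero d] (hP : IsRandomClusterLimit d b p q P)
    (hP' : IsRandomClusterLimit d b' p' q P') (hp : p ∈ Set.Icc (0 : ℝ) 1) (hp' : p' ∈ Set.Icc (0 : ℝ) 1)
    (hpp : p ≤ p') (hq : 1 ≤ q) (hbb : ∀ n : ℕ, b.wiredSet (box d n) ⊆ b'.wiredSet (box d n)) (x : Site d) :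
    P (percolatesAt x) ≤ P' (percolatesAt x) :=
  isRandomClusterLimit_measure_le hP hP' hp hp' hpp hq hbb (isUpperSet_percolatesAt x)
    (measurableSet_percolatesAt_holds x)

/-- **Monotonicity in `q`: `φ^b_{p,q'}(U) ≤ φ^b_{p,q}(U)` for `1 ≤ q ≤ q'`** and every measurable increasing event
of the infinite configuration. [this work] -/
theorem isRandomClusterLimit_anti_q (hP : IsRandomClusterLimit d b p q' P) (hP' : IsRandomClusterLimit d b p q P')
    (hp : p ∈ Set.Icc (0 : ℝ) 1) (hq : 1 ≤ q) (hqq : q ≤ q') {U : Set (BondConfig (Site d))} (hU : IsUpperSet U)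
    (hUm : MeasurableSet U) : P U ≤ P' U := by
  haveI := hP.isProbabilityMeasure
  haveI := hP'.isProbabilityMeasure
  simpa only [measure_univ, mul_one, one_mul] using
    holley_upperSet_of_crossBox_set P P' (crossBox_of_isRandomClusterLimit_q hP hP' hp hq hqq) hU hUm

/-- Integral form of the monotonicity in `q`. [this work] -/
theorem isRandomClusterLimit_integral_anti_q (hP : IsRandomClusterLimit d b p q' P)
    (hP' : IsRandomClusterLimit d b p q P') (hp : p ∈ Set.Icc (0 : ℝ) 1) (hq : 1 ≤ q) (hqq : q ≤ q')
    {f : BondConfig (Site d) → ℝ} (hf : Monotone f) (hfm : Measurable f) {C : ℝ} (hfC : ∀ x, |f x| ≤ C) :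
    ∫ x, f x ∂P ≤ ∫ x, f x ∂P' := by
  haveI := hP.isProbabilityMeasure
  haveI := hP'.isProbabilityMeasure
  exact holley_of_crossBox_set P P' (crossBox_of_isRandomClusterLimit_q hP hP' hp hq hqq) hf hfm hfC

end Limit

end Summit.CriticalPhenomena.PercolationContinuityZ3.Theorems.SahiBoxTP2
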